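import Mathlib
import Summits.NavierStokesRegularity.NavierStokesRegularity.Theorems.WakeRatchetTailRatchetRelaySolvability
import HarnessLib

/-!
# `WakeRatchet.TailRatchet` (stmt-NavierStokesRegularity-21808): the backward pantograph solution is
# BOUNDED, has a limit at `−∞`, and that limit is `−∫ w₁ f` (the solvability functional)

Support file for the crux `TailRatchet` (route `WakeRatchet`; MODEL lattice ODEs of Tao 2016 §1.2, §4 —
nothing in this file is a statement about the Navier–Stokes equations, and no item is closed here).

Context (`…RelaySolvability`, `…RelayGreen`; census of stmt-21808, programme "R-lac", step R-lac-2):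
`WakeRatchetRelaySolvability.pantograph_inhom_exists` solves `h' = 2e^{t/2}h(t/2) + f`, `h(0) = 0`, backward
on `(−∞,0]` with the a-priori growth `|h| ≤ Ce^{−t}`.  Here the growth is bootstrapped away and the value
at `−∞` is identified, sorry-free:

* `setIntegral_interval_le_Iic` — `∫_t^0 g ≤ ∫_{(−∞,0]} g` for `g ≥ 0` integrable (bookkeeping);
* `pantograph_inhom_linear_bound`, `pantograph_inhom_bounded` — **BOUNDEDNESS**: if `f` is continuous with
  `∫_{(−∞,0]}|f| < ∞`, every solution with `h(0) = 0` and `|h| ≤ Ce^{−t}` obeys first `|h(t)| ≤ 2C|t| + F`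
  and then `|h(t)| ≤ 16C + 5F` on `t ≤ 0` (`F = ∫_{(−∞,0]}|f|`; two rounds of `h(t) = −∫_t^0 h'`, using
  `|s|e^{s/2} ≤ 2e^{s/4}`);
* `pantograph_inhom_tendsto` — **LIMIT AND ITS VALUE**: such an `h`, if bounded, converges at `−∞` and
  `lim_{t→−∞} h(t) = −∫_{(−∞,0]} w₁ f` (Green's identity `WakeRatchetRelayGreen.adjoint_green`; `w₁` the
  adjoint mode).  In particular **`∫ w₁ f = 0 ⇒ h(−∞) = 0`** (`pantograph_inhom_tendsto_zero`): the
  solvability functional of the bordered linearisation is exactly `f ↦ ∫ w₁ f` — on the bounded class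
  `ker(∫w₁·) ⊆ {f : the normalised solution decays}`, complementing `WakeRatchetRelayGreen.range_annihilated`.

Remaining for R-lac (census): the decay RATE `h ∈ X_γ` when `∫w₁f = 0` (one more integration), the `C¹`
setting (R-lac-3) and the implicit function theorem (R-lac-4).  Fronts for lacunary `Λ` do NOT refute
`TailRatchet` (which needs `Λ → 1`).

HONEST FRAMING: elementary real analysis; MODEL lattice only; the construction item and the crux stay open.
-/

noncomputable section

set_option linter.dupNamespace false

namespace Summit.NavierStokesRegularity.NavierStokesRegularity.Theorems

namespace WakeRatchetRelaySolvabilityLimit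

open MeasureTheory Set Filter Topology Real intervalIntegral
open WakeRatchetRelayTransversality WakeRatchetRelayGreen WakeRatchetRelaySolvability

/-! ## Bookkeeping -/

/-- For `g ≥ 0` on `(−∞,0]`, integrable there, and `t ≤ 0`: `∫_t^0 g ≤ ∫_{(−∞,0]} g`. [folklore] -/
theorem setIntegral_interval_le_Iic {g : ℝ → ℝ} (hg : IntegrableOn g (Iic 0))
    (hnn : ∀ s : ℝ, s ≤ 0 → 0 ≤ g s) {t : ℝ} (ht : t ≤ 0) :
    ∫ s in t..0, g s ≤ ∫ s in Iic (0 : ℝ), g s := by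
  rw [intervalIntegral.integral_of_le ht]
  exact setIntegral_mono_set hg
    ((ae_restrict_iff' measurableSet_Iic).2 (Eventually.of_forall fun s hs => hnn s hs))
    (Ioc_subset_Iic_self.eventuallyLE)

/-- `∫_t^0 e^{ks} ds ≤ 1/k` for `k > 0`, `t ≤ 0`. [folklore] -/
theorem integral_exp_mul_interval_le {k : ℝ} (hk : 0 < k) {t : ℝ} (ht : t ≤ 0) :
    ∫ s in t..0, Real.exp (k * s) ≤ 1 / k := by
  rw [← integral_exp_mul_Iic_zero hk]
  exact setIntegral_interval_le_Iic (integrableOn_exp_mul_Iic hk 0) (fun s _ => (Real.exp_pos _).le) ht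

/-- `|s| e^{s/2} ≤ 2 e^{s/4}` on `s ≤ 0`. [folklore] -/
theorem abs_mul_exp_half_le {s : ℝ} (hs : s ≤ 0) : |s| * Real.exp (s / 2) ≤ 2 * Real.exp (s / 4) := by
  have h1 : |s| / 4 * Real.exp (-(|s| / 4)) ≤ Real.exp (-1) :=
    WakeRatchetRelaySolvability.mul_exp_neg_le_exp_neg_one _
  have h2 : Real.exp (-1) ≤ 1 / 2 := by
    have := Real.exp_one_gt_d9
    rw [Real.exp_neg, inv_le_comm₀ (Real.exp_pos 1) (by norm_num)]
    linarith
  have habs : |s| = -s := abs_of_nonpos hs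
  have hexp : Real.exp (s / 2) = Real.exp (-(|s| / 4)) * Real.exp (s / 4) := by
    rw [← Real.exp_add, habs]; ring_nf
  rw [hexp, ← mul_assoc]
  have h3 : |s| * Real.exp (-(|s| / 4)) ≤ 2 := by
    have : |s| * Real.exp (-(|s| / 4)) = 4 * (|s| / 4 * Real.exp (-(|s| / 4))) := by ring
    rw [this]; linarith
  exact mul_le_mul_of_nonneg_right h3 (Real.exp_pos _).le

variable {f h : ℝ → ℝ} {C : ℝ}

/-- The derivative `h'(s) = 2e^{s/2}h(s/2) + f(s)` is continuous on `(−∞,0]`. [folklore] -/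
theorem deriv_continuousOn (hf : Continuous f) (hcont : ContinuousOn h (Iic 0)) :
    ContinuousOn (fun s : ℝ => 2 * Real.exp (s / 2) * h (s / 2) + f s) (Iic 0) := by
  have hh2 : ContinuousOn (fun s : ℝ => h (s / 2)) (Iic 0) :=
    hcont.comp (continuous_id.div_const 2).continuousOn
      (fun s hs => by simp only [mem_Iic] at hs ⊢; linarith)
  exact (((continuous_const.mul (Real.continuous_exp.comp (continuous_id.div_const 2))).continuousOn).mul
    hh2).add hf.continuousOn

/-- `h(t) = −∫_t^0 h'` for a solution with `h(0) = 0` (fundamental theorem of calculus on `[t,0]`). [folklore] -/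
theorem eq_neg_integral (hf : Continuous f) (hcont : ContinuousOn h (Iic 0))
    (hde : ∀ t : ℝ, t < 0 → HasDerivAt h (2 * Real.exp (t / 2) * h (t / 2) + f t) t) (h0 : h 0 = 0)
    {t : ℝ} (ht : t ≤ 0) :
    h t = -∫ s in t..0, (2 * Real.exp (s / 2) * h (s / 2) + f s) := by
  have hco := (deriv_continuousOn hf hcont).mono (Icc_subset_Iic_self : Icc t 0 ⊆ Iic 0)
  have hFTC := intervalIntegral.integral_eq_sub_of_hasDerivAt_of_le ht (hcont.mono Icc_subset_Iic_self)
    (fun x hx => hde x hx.2) (hco.intervalIntegrable_of_Icc ht)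
  rw [hFTC, h0]; ring

/-! ## Boundedness by bootstrap -/

/-- **Round 1: linear growth.**  `|h(t)| ≤ 2C|t| + ∫_{(−∞,0]}|f|` on `t ≤ 0`. [folklore] -/
theorem pantograph_inhom_linear_bound (hf : Continuous f) (hfi : IntegrableOn f (Iic 0))
    (hcont : ContinuousOn h (Iic 0))
    (hde : ∀ t : ℝ, t < 0 → HasDerivAt h (2 * Real.exp (t / 2) * h (t / 2) + f t) t) (h0 : h 0 = 0)
    (hC : ∀ t : ℝ, t ≤ 0 → |h t| ≤ C * Real.exp (-t)) {t : ℝ} (ht : t ≤ 0) :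
    |h t| ≤ 2 * C * |t| + ∫ s in Iic (0 : ℝ), |f s| := by
  have hC0 : 0 ≤ C := by
    have := hC 0 le_rfl
    rw [neg_zero, Real.exp_zero, mul_one] at this
    exact (abs_nonneg _).trans this
  rw [eq_neg_integral hf hcont hde h0 ht, abs_neg]
  have hco := (deriv_continuousOn hf hcont).mono (Icc_subset_Iic_self : Icc t 0 ⊆ Iic 0)
  -- pointwise bound on `[t,0]`
  have hpt : ∀ s ∈ Ioc t 0, ‖2 * Real.exp (s / 2) * h (s / 2) + f s‖ ≤ 2 * C + |f s| := by
    intro s hs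
    have hs0 : s ≤ 0 := hs.2
    have hh := hC (s / 2) (by linarith)
    have he : Real.exp (s / 2) * Real.exp (-(s / 2)) = 1 := by
      rw [← Real.exp_add, add_neg_cancel, Real.exp_zero]
    rw [Real.norm_eq_abs]
    calc |2 * Real.exp (s / 2) * h (s / 2) + f s| ≤ |2 * Real.exp (s / 2) * h (s / 2)| + |f s| :=
          abs_add_le _ _
      _ = 2 * Real.exp (s / 2) * |h (s / 2)| + |f s| := by
          rw [abs_mul, abs_mul, abs_two, abs_of_pos (Real.exp_pos _)]
      _ ≤ 2 * Real.exp (s / 2) * (C * Real.exp (-(s / 2))) + |f s| := by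
          have := mul_le_mul_of_nonneg_left hh (by positivity : (0 : ℝ) ≤ 2 * Real.exp (s / 2))
          linarith
      _ = 2 * C * (Real.exp (s / 2) * Real.exp (-(s / 2))) + |f s| := by ring
      _ = 2 * C + |f s| := by rw [he, mul_one]
  have hgi : IntervalIntegrable (fun s : ℝ => 2 * C + |f s|) volume t 0 :=
    (intervalIntegrable_const).add ((hf.continuousOn.abs).intervalIntegrable_of_Icc ht |>.mono_set
      (by rw [uIcc_of_le ht]))
  have h1 := intervalIntegral.norm_integral_le_of_norm_le ht (Eventually.of_forall hpt) hgi
  rw [Real.norm_eq_abs] at h1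
  have h2 : ∫ s in t..0, (2 * C + |f s|) = 2 * C * (0 - t) + ∫ s in t..0, |f s| := by
    rw [intervalIntegral.integral_add intervalIntegrable_const
      ((hf.continuousOn.abs).intervalIntegrable_of_Icc ht |>.mono_set (by rw [uIcc_of_le ht])),
      intervalIntegral.integral_const, smul_eq_mul]
    ring
  have h3 : ∫ s in t..0, |f s| ≤ ∫ s in Iic (0 : ℝ), |f s| :=
    setIntegral_interval_le_Iic hfi.abs (fun s _ => abs_nonneg _) ht
  rw [abs_of_nonpos ht]
  linarith

/-- **Round 2: BOUNDEDNESS.**  `|h(t)| ≤ 16C + 5∫_{(−∞,0]}|f|` on `t ≤ 0`.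
[cite: Tao2016AveragedNS, §1.2 (dyadic model); cell vocabulary (programme R-lac, step R-lac-2)] -/
theorem pantograph_inhom_bounded (hf : Continuous f) (hfi : IntegrableOn f (Iic 0))
    (hcont : ContinuousOn h (Iic 0))
    (hde : ∀ t : ℝ, t < 0 → HasDerivAt h (2 * Real.exp (t / 2) * h (t / 2) + f t) t) (h0 : h 0 = 0)
    (hC : ∀ t : ℝ, t ≤ 0 → |h t| ≤ C * Real.exp (-t)) {t : ℝ} (ht : t ≤ 0) :
    |h t| ≤ 16 * C + 5 * ∫ s in Iic (0 : ℝ), |f s| := by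
  set F : ℝ := ∫ s in Iic (0 : ℝ), |f s| with hF
  have hF0 : 0 ≤ F := integral_nonneg fun s => abs_nonneg _
  have hC0 : 0 ≤ C := by
    have := hC 0 le_rfl
    rw [neg_zero, Real.exp_zero, mul_one] at this
    exact (abs_nonneg _).trans this
  rw [eq_neg_integral hf hcont hde h0 ht, abs_neg]
  -- pointwise bound on `[t,0]` using round 1 at `s/2`
  have hpt : ∀ s ∈ Ioc t 0, ‖2 * Real.exp (s / 2) * h (s / 2) + f s‖ ≤
      4 * C * Real.exp (1 / 4 * s) + 2 * F * Real.exp (1 / 2 * s) + |f s| := by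
    intro s hs
    have hs0 : s ≤ 0 := hs.2
    have hh := pantograph_inhom_linear_bound hf hfi hcont hde h0 hC (show s / 2 ≤ 0 by linarith)
    rw [← hF, show |s / 2| = |s| / 2 by rw [abs_div, abs_two]] at hh
    have hse := abs_mul_exp_half_le hs0
    rw [Real.norm_eq_abs]
    have e0 : 0 ≤ Real.exp (s / 2) := (Real.exp_pos _).le
    calc |2 * Real.exp (s / 2) * h (s / 2) + f s| ≤ |2 * Real.exp (s / 2) * h (s / 2)| + |f s| :=
          abs_add_le _ _
      _ = 2 * Real.exp (s / 2) * |h (s / 2)| + |f s| := by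
          rw [abs_mul, abs_mul, abs_two, abs_of_pos (Real.exp_pos _)]
      _ ≤ 2 * Real.exp (s / 2) * (2 * C * (|s| / 2) + F) + |f s| := by
          have := mul_le_mul_of_nonneg_left hh (by positivity : (0 : ℝ) ≤ 2 * Real.exp (s / 2))
          linarith
      _ = 2 * C * (|s| * Real.exp (s / 2)) + 2 * F * Real.exp (s / 2) + |f s| := by ring
      _ ≤ 2 * C * (2 * Real.exp (s / 4)) + 2 * F * Real.exp (s / 2) + |f s| := by
          have := mul_le_mul_of_nonneg_left hse (by positivity : (0 : ℝ) ≤ 2 * C)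
          linarith
      _ = 4 * C * Real.exp (1 / 4 * s) + 2 * F * Real.exp (1 / 2 * s) + |f s| := by ring_nf
  have hfabs : IntervalIntegrable (fun s : ℝ => |f s|) volume t 0 :=
    (hf.continuousOn.abs).intervalIntegrable_of_Icc ht |>.mono_set (by rw [uIcc_of_le ht])
  have he4 : IntervalIntegrable (fun s : ℝ => 4 * C * Real.exp (1 / 4 * s)) volume t 0 :=
    ((Real.continuous_exp.comp (continuous_const.mul continuous_id)).intervalIntegrable _ _).const_mul _
  have he2 : IntervalIntegrable (fun s : ℝ => 2 * F * Real.exp (1 / 2 * s)) volume t 0 :=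
    ((Real.continuous_exp.comp (continuous_const.mul continuous_id)).intervalIntegrable _ _).const_mul _
  have hgi : IntervalIntegrable (fun s : ℝ =>
      4 * C * Real.exp (1 / 4 * s) + 2 * F * Real.exp (1 / 2 * s) + |f s|) volume t 0 :=
    (he4.add he2).add hfabs
  have h1 := intervalIntegral.norm_integral_le_of_norm_le ht (Eventually.of_forall hpt) hgi
  rw [Real.norm_eq_abs] at h1
  have h2 : ∫ s in t..0, (4 * C * Real.exp (1 / 4 * s) + 2 * F * Real.exp (1 / 2 * s) + |f s|) =
      4 * C * (∫ s in t..0, Real.exp (1 / 4 * s)) + 2 * F * (∫ s in t..0, Real.exp (1 / 2 * s)) +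
        ∫ s in t..0, |f s| := by
    rw [intervalIntegral.integral_add (he4.add he2) hfabs, intervalIntegral.integral_add he4 he2,
      intervalIntegral.integral_const_mul, intervalIntegral.integral_const_mul]
  have h3 : ∫ s in t..0, |f s| ≤ F := setIntegral_interval_le_Iic hfi.abs (fun s _ => abs_nonneg _) ht
  have h4 := integral_exp_mul_interval_le (by norm_num : (0 : ℝ) < 1 / 4) ht
  have h5 := integral_exp_mul_interval_le (by norm_num : (0 : ℝ) < 1 / 4 * 2) ht
  have h44 : (1 : ℝ) / (1 / 4) = 4 := by norm_num
  have h55 : (1 : ℝ) / (1 / 4 * 2) = 2 := by norm_num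
  have h52 : (fun s : ℝ => Real.exp (1 / 4 * 2 * s)) = fun s : ℝ => Real.exp (1 / 2 * s) := by
    funext s; norm_num
  rw [h44] at h4
  rw [h55, h52] at h5
  have h6 : 4 * C * (∫ s in t..0, Real.exp (1 / 4 * s)) ≤ 4 * C * 4 :=
    mul_le_mul_of_nonneg_left h4 (by positivity)
  have h7 : 2 * F * (∫ s in t..0, Real.exp (1 / 2 * s)) ≤ 2 * F * 2 :=
    mul_le_mul_of_nonneg_left h5 (by positivity)
  linarith [h1, h2, h3, h6, h7]

/-! ## The limit at `−∞` and its value -/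

/-- **LIMIT AND ITS VALUE.**  A bounded solution of `h' = 2e^{t/2}h(t/2) + f`, `h(0) = 0`, on `(−∞,0]`
(`f` continuous and integrable on the half-line) converges as `t → −∞`, to `−∫_{(−∞,0]} w₁ f`, where
`w₁ = Σ_m c_m e^{(2^m−1)t}` is the adjoint mode.
[cite: Tao2016AveragedNS, §1.2 (dyadic model); cell vocabulary (solvability functional of the bordered linearisation at the relay profile; programme R-lac, step R-lac-2)] -/
theorem pantograph_inhom_tendsto (hf : Continuous f) (hfi : IntegrableOn f (Iic 0))
    (hcont : ContinuousOn h (Iic 0))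
    (hde : ∀ t : ℝ, t < 0 → HasDerivAt h (2 * Real.exp (t / 2) * h (t / 2) + f t) t) (h0 : h 0 = 0)
    {B : ℝ} (hB : ∀ t : ℝ, t ≤ 0 → |h t| ≤ B) :
    Tendsto h atBot (𝓝 (-∫ t in Iic (0 : ℝ), (∑' m : ℕ,
      (∏ i ∈ Finset.range m, ((-4 : ℝ) / (2 ^ (i + 1) - 1))) * Real.exp ((2 ^ m - 1) * t)) * f t)) := by
  have hB0 : 0 ≤ B := (abs_nonneg _).trans (hB 0 le_rfl)
  set G : ℝ → ℝ := fun s => 2 * Real.exp (s / 2) * h (s / 2) + f s with hG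
  -- `G` is integrable on the half-line
  have hGcont : ContinuousOn G (Iic 0) := deriv_continuousOn hf hcont
  have hGint : IntegrableOn G (Iic 0) := by
    have h1 : IntegrableOn (fun s : ℝ => 2 * Real.exp (s / 2) * h (s / 2)) (Iic 0) := by
      have hmaj : IntegrableOn (fun s : ℝ => 2 * B * Real.exp ((1 / 2) * s)) (Iic 0) :=
        (integrableOn_exp_mul_Iic (by norm_num : (0 : ℝ) < 1 / 2) 0).const_mul _
      have hh2 : ContinuousOn (fun s : ℝ => h (s / 2)) (Iic 0) :=
        hcont.comp (continuous_id.div_const 2).continuousOn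
          (fun s hs => by simp only [mem_Iic] at hs ⊢; linarith)
      refine Integrable.mono' hmaj ?_ ?_
      · exact (((continuous_const.mul (Real.continuous_exp.comp (continuous_id.div_const 2))).continuousOn).mul
          hh2) |>.aestronglyMeasurable measurableSet_Iic
      · refine (ae_restrict_iff' measurableSet_Iic).2 (Eventually.of_forall fun s hs => ?_)
        have hs2 : s / 2 ≤ 0 := by simp only [mem_Iic] at hs; linarith
        rw [Real.norm_eq_abs, abs_mul, abs_mul, abs_two, abs_of_pos (Real.exp_pos _),
          show (1 : ℝ) / 2 * s = s / 2 by ring]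
        calc 2 * Real.exp (s / 2) * |h (s / 2)| ≤ 2 * Real.exp (s / 2) * B :=
            mul_le_mul_of_nonneg_left (hB _ hs2) (by positivity)
          _ = 2 * B * Real.exp (s / 2) := by ring
    exact h1.add hfi
  -- the limit of `−∫_t^0 G`
  have hlimI : Tendsto (fun t : ℝ => ∫ s in t..0, G s) atBot (𝓝 (∫ s in Iic (0 : ℝ), G s)) :=
    intervalIntegral_tendsto_integral_Iic 0 hGint tendsto_id
  have hlim : Tendsto h atBot (𝓝 (-∫ s in Iic (0 : ℝ), G s)) := by
    refine (hlimI.neg).congr' ?_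
    filter_upwards [eventually_le_atBot (0 : ℝ)] with t ht
    exact (eq_neg_integral hf hcont hde h0 ht).symm
  -- Green's identity identifies the limit
  set W : ℝ → ℝ := fun t : ℝ => ∑' m : ℕ,
      (∏ i ∈ Finset.range m, ((-4 : ℝ) / (2 ^ (i + 1) - 1))) * Real.exp ((2 ^ m - 1) * t) with hW
  have hGreen := adjoint_green W hW hcont hde hB hGint hlim
  have hfun : (fun t : ℝ => W t * (G t - 2 * Real.exp (t / 2) * h (t / 2))) = fun t : ℝ => W t * f t := by
    funext t; simp only [hG]; ring
  rw [hfun, h0, mul_zero, zero_sub, neg_neg] at hGreen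
  -- `∫ W f = ∫ G`, so the limit `−∫ G` is `−∫ W f`
  rw [← hGreen] at hlim
  exact hlim

/-- **`∫ w₁ f = 0 ⇒ h(−∞) = 0`.**  If the solvability functional vanishes, the normalised backward solution
decays at `−∞`. [folklore] -/
theorem pantograph_inhom_tendsto_zero (hf : Continuous f) (hfi : IntegrableOn f (Iic 0))
    (hcont : ContinuousOn h (Iic 0))
    (hde : ∀ t : ℝ, t < 0 → HasDerivAt h (2 * Real.exp (t / 2) * h (t / 2) + f t) t) (h0 : h 0 = 0)
    {B : ℝ} (hB : ∀ t : ℝ, t ≤ 0 → |h t| ≤ B)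
    (horth : ∫ t in Iic (0 : ℝ), (∑' m : ℕ,
      (∏ i ∈ Finset.range m, ((-4 : ℝ) / (2 ^ (i + 1) - 1))) * Real.exp ((2 ^ m - 1) * t)) * f t = 0) :
    Tendsto h atBot (𝓝 0) := by
  have := pantograph_inhom_tendsto hf hfi hcont hde h0 hB
  rwa [horth, neg_zero] at this

/-- **SOLVABILITY PACKAGE (existence form).**  For `f` continuous, bounded and integrable on `(−∞,0]`
there is a solution `h` of `h' = 2e^{t/2}h(t/2) + f`, `h(0) = 0`, continuous on `ℝ`, BOUNDED on `(−∞,0]`,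
converging at `−∞` to `−∫ w₁ f`. [folklore] -/
theorem pantograph_inhom_exists_bounded {A : ℝ} (hf : Continuous f) (hA : ∀ s : ℝ, s ≤ 0 → |f s| ≤ A)
    (hfi : IntegrableOn f (Iic 0)) :
    ∃ h : ℝ → ℝ, Continuous h ∧ h 0 = 0 ∧
      (∀ t : ℝ, t < 0 → HasDerivAt h (2 * Real.exp (t / 2) * h (t / 2) + f t) t) ∧
      (∃ B : ℝ, ∀ t : ℝ, t ≤ 0 → |h t| ≤ B) ∧
      Tendsto h atBot (𝓝 (-∫ t in Iic (0 : ℝ), (∑' m : ℕ,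
        (∏ i ∈ Finset.range m, ((-4 : ℝ) / (2 ^ (i + 1) - 1))) * Real.exp ((2 ^ m - 1) * t)) * f t)) := by
  obtain ⟨h, hc, h0, hde, C, hC⟩ := pantograph_inhom_exists hf hA
  have hB : ∀ t : ℝ, t ≤ 0 → |h t| ≤ 16 * C + 5 * ∫ s in Iic (0 : ℝ), |f s| :=
    fun t ht => pantograph_inhom_bounded hf hfi hc.continuousOn hde h0 hC ht
  exact ⟨h, hc, h0, hde, ⟨_, hB⟩, pantograph_inhom_tendsto hf hfi hc.continuousOn hde h0 hB⟩

end WakeRatchetRelaySolvabilityLimit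

end Summit.NavierStokesRegularity.NavierStokesRegularity.Theorems

end
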